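import Literature.AnabelianGeometry.SemiGraphs.FreeGroupsAndActions
import Literature.GroupTheory.CombinatorialGroupTheory.FreeGroupResiduallyP

/-!
# Free groups and finite group actions on semi-graphs: proofs, V — Remark 1.7.1 ([SemiAnbd] §1, p. 20)

Mochizuki, *Semi-graphs of Anabelioids*, Publ. RIMS **42** (2006) 221–322, §1, author's manuscript
p. 20 [cite: MochizukiSemiAnbd2006, Rem. 1.7.1 p.20].  Proof-only companion of
`FreeGroupsAndActions.lean` (abc-iut-L3-t1, p404224):

* `remark_1_7_1_holds` — Remark 1.7.1, "there is also a pro-`l` version of this residual finiteness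
  result — cf., e.g., [RZ], Proposition 3.3.15": every non-trivial element of a free group lies
  outside some normal subgroup of index a power of the prime `l`.  This is the general theorem
  `FreeGroup.exists_normal_index_prime_pow_notMem` of
  `Literature/GroupTheory/CombinatorialGroupTheory/FreeGroupResiduallyP.lean` (truncated Magnus
  representation over `ℤ/l^k`, whose unipotent group is a finite `l`-group).
-/

namespace Literature.AnabelianGeometry.SemiGraphs

universe u

/-- DISCHARGE of the named fact `remark_1_7_1` ([SemiAnbd] Remark 1.7.1, the pro-`l` version of the
residual finiteness of free groups, [RZ] Prop. 3.3.15): for a prime `l`, every `x ≠ 1` of a free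
group lies outside some normal subgroup of index a power of `l`.
[cite: MochizukiSemiAnbd2006, Rem. 1.7.1 p.20] -/
theorem remark_1_7_1_holds : remark_1_7_1.{u} :=
  fun _ _ hl x hx => FreeGroup.exists_normal_index_prime_pow_notMem hl x hx

end Literature.AnabelianGeometry.SemiGraphs
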